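import Mathlib.Analysis.SpecialFunctions.Gaussian.FourierTransform
import Mathlib.Analysis.SpecialFunctions.JapaneseBracket
import Mathlib.Analysis.SpecialFunctions.Gamma.Beta
import Literature.Analysis.FunctionSpaces.BesselKMellin
import HarnessLib

/-!
# Basset's integral: the Fourier transform of `(t² + y²)^{-s}` is a `K`-Bessel function (Iwaniec (3.18)–(3.19))

Sibling proof file of `BesselK.lean` / `BesselKMellin.lean` (one auxiliary definition, the
two-variable kernel `bassetKernel`; otherwise theorems only). The two integrals with which Iwaniec
evaluates the Fourier expansion of the Eisenstein series of a general Fuchsian group at a cusp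
(Theorem 3.4: `E_𝔞(σ_𝔟z, s) = δ_𝔞𝔟 y^s + φ_𝔞𝔟(s) y^{1-s} + Σ_{n≠0} φ_𝔞𝔟(n, s) W_s(nz)`, from the
general expansion (3.17) of `FuchsianPoincareSeries.lean` with `m = 0`, `ψ = y^s`):

* (3.18) `∫_ℝ (t² + y²)^{-s} dt = √π Γ(s - 1/2) Γ(s)⁻¹ y^{1-2s}` (`integral_sq_add_sq_cpow_neg`),
* (3.19) `∫_ℝ (t² + y²)^{-s} e(-nt) dt = 2 π^s Γ(s)⁻¹ |n|^{s-1/2} y^{1/2-s} K_{s-1/2}(2π|n|y)`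
  (`integral_sq_add_sq_cpow_neg_mul_cexp`, in the equivalent form
  `2√π (π|n|/y)^{s-1/2} K_{s-1/2}(2π|n|y)/Γ(s)`; Basset's integral, Watson §6.16 (1)),

for `y > 0`, `Re s > 1/2` (and `n ≠ 0`), everything PROVED by the classical device ("see Appendix B"):
`(t²+y²)^{-s} Γ(s) = ∫₀^∞ u^{s-1} e^{-u(t²+y²)} du`, Fubini on `ℝ × (0,∞)` (`integrable_bassetKernel`,
Tonelli with the norm sections `Γ(σ)(t²+y²)^{-σ} ∈ L¹(ℝ)` for `σ > 1/2`), the Gaussian Fourier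
transform `∫_ℝ e^{-ut²} e(-nt) dt = √(π/u) e^{-π²n²/u}` (Mathlib's `integral_cexp_quadratic`), and the
tree's `∫₀^∞ u^{ν-1} e^{-Au - B/u} du = 2(B/A)^{ν/2} K_ν(2√(AB))` (`integral_cpow_mul_exp_neg_mul_sub_div`).

## References
* [Iwaniec2002] H. Iwaniec, *Spectral Methods of Automorphic Forms*, 2nd ed., GSM 53, AMS 2002,
  §3.4 (3.18)–(3.19) & Theorem 3.4, Appendix B.4, PDF pp. 46, 150–152
  (held copy `book:iwaniec2002-spectral-methods-automorphic-forms`).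
* G. N. Watson, *A Treatise on the Theory of Bessel Functions*, 2nd ed., §6.16 (1) (Basset's integral).
* [BatemanGrosswald1964] for the definition of `K_ν` (`BesselK.lean`).

Mathlib: `integral_cexp_quadratic`, `integrable_rpow_neg_one_add_norm_sq`, `MeasureTheory.integrable_prod_iff`,
`integral_integral_swap`, `Complex.integral_cpow_mul_exp_neg_mul_Ioi`, `Real.integral_rpow_mul_exp_neg_mul_Ioi`,
`Complex.Gamma_ne_zero_of_re_pos`, `Complex.inv_cpow`, `Complex.ofReal_cpow`.
Literature: `besselK` (`BesselK.lean`), `integral_cpow_mul_exp_neg_mul_sub_div` (`BesselKMellin.lean`).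
Tree search (`lean search 'sq_add_sq.*cpow|Basset|fourier.*besselK' --decl`): nothing of the kind.
-/

noncomputable section

namespace Literature.Analysis.FunctionSpaces

open MeasureTheory Set Real _root_.Complex Filter
open scoped Topology

/-! ## 1. One-variable ingredients -/

section Ingredients

/-- `(t² + y²)^{-s} Γ(s) = ∫₀^∞ u^{s-1} e^{-u(t²+y²)} du` (`Re s > 0`): the Gamma integral with
`r = t² + y² > 0`, and `(1/r)^s = r^{-s}` for a positive real `r`. [folklore] -/
theorem integral_cpow_mul_exp_neg_mul_sq_add_sq {s : ℂ} (hs : 0 < s.re) {y : ℝ} (hy : 0 < y) (t : ℝ) :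
    ∫ u in Ioi (0 : ℝ), (u : ℂ) ^ (s - 1) * Complex.exp (-((t ^ 2 + y ^ 2 : ℝ) * u)) =
      ((t ^ 2 + y ^ 2 : ℝ) : ℂ) ^ (-s) * Complex.Gamma s := by
  have hr : 0 < t ^ 2 + y ^ 2 := by positivity
  rw [Complex.integral_cpow_mul_exp_neg_mul_Ioi hs hr]
  congr 1
  rw [Complex.cpow_neg, one_div, Complex.inv_cpow _ _ (by
    rw [Complex.arg_ofReal_of_nonneg hr.le]; exact Real.pi_pos.ne)]

/-- **The Gaussian Fourier transform**: `∫_ℝ e^{-ut²} e(-nt) dt = √(π/u) e^{-π²n²/u}` (`u > 0`).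
[folklore] -/
theorem integral_cexp_neg_mul_sq_mul_cexp {u : ℝ} (hu : 0 < u) (n : ℝ) :
    ∫ t : ℝ, Complex.exp (-((u : ℂ) * (t : ℂ) ^ 2)) * Complex.exp (-(2 * π * I * n * t)) =
      ((Real.sqrt (π / u) : ℝ) : ℂ) * Complex.exp (-((π ^ 2 * n ^ 2 / u : ℝ) : ℂ)) := by
  have hb : (-(u : ℂ)).re < 0 := by simp [hu]
  have h := integral_cexp_quadratic hb (-(2 * π * I * n)) 0
  have e : ∀ t : ℝ, Complex.exp (-((u : ℂ) * (t : ℂ) ^ 2)) * Complex.exp (-(2 * π * I * n * t)) =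
      Complex.exp (-(u : ℂ) * (t : ℂ) ^ 2 + -(2 * π * I * n) * t + 0) := by
    intro t; rw [← Complex.exp_add]; congr 1; ring
  simp_rw [e]
  rw [h, neg_neg]
  have hu0 : (u : ℂ) ≠ 0 := Complex.ofReal_ne_zero.mpr hu.ne'
  congr 1
  · rw [show (π : ℂ) / (u : ℂ) = ((π / u : ℝ) : ℂ) by push_cast; rfl,
      show (1 / 2 : ℂ) = ((1 / 2 : ℝ) : ℂ) by push_cast; rfl, ← Complex.ofReal_cpow (by positivity),
      Real.sqrt_eq_rpow]
  · congr 1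
    push_cast
    field_simp
    linear_combination (4 * (π : ℂ) ^ 2 * (n : ℂ) ^ 2) * Complex.I_sq

/-- Integrability of `t ↦ (t² + y²)^{-σ}` on `ℝ` for `σ > 1/2`. [folklore] -/
theorem integrable_sq_add_sq_rpow_neg {σ : ℝ} (hσ : 1 / 2 < σ) {y : ℝ} (hy : 0 < y) :
    Integrable fun t : ℝ => (t ^ 2 + y ^ 2) ^ (-σ) := by
  have h1 : Integrable fun t : ℝ => ((1 : ℝ) + ‖t‖ ^ 2) ^ (-(2 * σ) / 2) :=
    integrable_rpow_neg_one_add_norm_sq (E := ℝ) (by simp; linarith)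
  have h2 : Integrable fun t : ℝ => ((1 : ℝ) + ‖y⁻¹ * t‖ ^ 2) ^ (-(2 * σ) / 2) :=
    h1.comp_mul_left' (inv_ne_zero hy.ne')
  refine ((h2.const_mul ((y ^ 2) ^ (-σ)))).congr (Eventually.of_forall fun t => ?_)
  simp only
  rw [Real.norm_eq_abs, sq_abs, show -(2 * σ) / 2 = -σ by ring, ← Real.mul_rpow (by positivity) (by positivity)]
  congr 1
  field_simp
  ring

end Ingredients

/-! ## 2. Fubini for the kernel `u^{s-1} e^{-u(t²+y²)} e(-nt)` on `ℝ × (0, ∞)` -/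

section Fubini

variable {s : ℂ} {y n : ℝ}

/-- The two-variable kernel. [folklore] -/
def bassetKernel (s : ℂ) (y n : ℝ) (p : ℝ × ℝ) : ℂ :=
  (p.2 : ℂ) ^ (s - 1) * Complex.exp (-((p.1 ^ 2 + y ^ 2 : ℝ) * p.2)) * Complex.exp (-(2 * π * I * n * p.1))

/-- Its norm: `u^{Re s - 1} e^{-u(t²+y²)}` (`u > 0`). [folklore] -/
theorem norm_bassetKernel {u : ℝ} (hu : 0 < u) (t : ℝ) :
    ‖bassetKernel s y n (t, u)‖ = u ^ (s.re - 1) * Real.exp (-((t ^ 2 + y ^ 2) * u)) := by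
  rw [bassetKernel, norm_mul, norm_mul, Complex.norm_cpow_eq_rpow_re_of_pos hu, Complex.sub_re, Complex.one_re,
    Complex.norm_exp, Complex.norm_exp]
  have e1 : (-(((t ^ 2 + y ^ 2 : ℝ) : ℂ) * (u : ℂ))).re = -((t ^ 2 + y ^ 2) * u) := by
    rw [← Complex.ofReal_mul, ← Complex.ofReal_neg, Complex.ofReal_re]
  have e2 : (-(2 * (π : ℂ) * I * n * t)).re = 0 := by
    simp [Complex.mul_re, Complex.mul_im]
  rw [e1, e2, Real.exp_zero, mul_one]

/-- **Integrability of the kernel on `ℝ × (0, ∞)`** for `Re s > 1/2`, `y > 0` (Tonelli: the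
`u`-integral of the norm is `Γ(σ)(t² + y²)^{-σ}`, integrable in `t`). [folklore] -/
theorem integrable_bassetKernel (hs : 1 / 2 < s.re) (hy : 0 < y) :
    Integrable (bassetKernel s y n) ((volume : Measure ℝ).prod (volume.restrict (Ioi (0 : ℝ)))) := by
  have hs0 : 0 < s.re := by linarith
  -- measurability: continuous on `ℝ × (0, ∞)`
  have hmeas : AEStronglyMeasurable (bassetKernel s y n) ((volume : Measure ℝ).prod (volume.restrict (Ioi (0 : ℝ)))) := by
    have e : (volume : Measure ℝ).prod (volume.restrict (Ioi (0 : ℝ))) =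
        ((volume : Measure ℝ).prod volume).restrict (Set.univ ×ˢ Ioi (0 : ℝ)) := by
      rw [← Measure.prod_restrict, Measure.restrict_univ]
    rw [e]
    refine ContinuousOn.aestronglyMeasurable ?_ (MeasurableSet.univ.prod measurableSet_Ioi)
    intro p hp
    have hp2 : 0 < p.2 := hp.2
    unfold bassetKernel
    refine ContinuousAt.continuousWithinAt ?_
    apply ContinuousAt.mul
    · apply ContinuousAt.mul
      · exact (Complex.continuousAt_ofReal_cpow_const p.2 (s - 1) (Or.inr hp2.ne')).comp continuousAt_snd
      · exact (Complex.continuous_exp.comp ((Complex.continuous_ofReal.comp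
          ((continuous_fst.pow 2).add continuous_const)).mul (Complex.continuous_ofReal.comp continuous_snd)).neg).continuousAt
    · exact (Complex.continuous_exp.comp ((continuous_const.mul (Complex.continuous_ofReal.comp continuous_fst))).neg).continuousAt
  rw [MeasureTheory.integrable_prod_iff hmeas]
  constructor
  · -- sections: integrable in `u` for every `t` (the Gamma integral is finite and nonzero)
    refine Eventually.of_forall fun t => ?_
    have hval := integral_cpow_mul_exp_neg_mul_sq_add_sq hs0 hy t
    have hne : ((t ^ 2 + y ^ 2 : ℝ) : ℂ) ^ (-s) * Complex.Gamma s ≠ 0 := by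
      refine mul_ne_zero ?_ (Complex.Gamma_ne_zero_of_re_pos hs0)
      rw [Complex.cpow_ne_zero_iff]
      exact Or.inl (Complex.ofReal_ne_zero.mpr (by positivity))
    have hint : Integrable (fun u : ℝ => (u : ℂ) ^ (s - 1) * Complex.exp (-((t ^ 2 + y ^ 2 : ℝ) * u)))
        (volume.restrict (Ioi 0)) := by
      by_contra H
      exact hne (by rw [← hval]; exact integral_undef H)
    refine (hint.mul_const (Complex.exp (-(2 * π * I * n * t)))).congr (Eventually.of_forall fun u => ?_)
    simp only [bassetKernel]
  · -- the norm sections: `∫₀^∞ u^{σ-1} e^{-u(t²+y²)} du = Γ(σ) (t²+y²)^{-σ}`, integrable in `t`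
    have e : ∀ t : ℝ, (∫ u in Ioi (0 : ℝ), ‖bassetKernel s y n (t, u)‖) =
        (1 / (t ^ 2 + y ^ 2)) ^ s.re * Real.Gamma s.re := by
      intro t
      have hr : 0 < t ^ 2 + y ^ 2 := by positivity
      rw [← Real.integral_rpow_mul_exp_neg_mul_Ioi hs0 hr]
      refine setIntegral_congr_fun measurableSet_Ioi fun u hu => ?_
      rw [norm_bassetKernel hu]
    have e' : (fun t : ℝ => ∫ u in Ioi (0 : ℝ), ‖bassetKernel s y n (t, u)‖) =
        fun t : ℝ => Real.Gamma s.re * (t ^ 2 + y ^ 2) ^ (-s.re) := by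
      funext t
      rw [e t, Real.rpow_neg (by positivity), one_div, Real.inv_rpow (by positivity)]
      ring
    rw [e']
    exact (integrable_sq_add_sq_rpow_neg hs hy).const_mul _

end Fubini

/-! ## 3. Basset's integral and Iwaniec's (3.18)–(3.19) -/

section Basset

/-- **Steps 1–3 of Basset's evaluation, for every real `n`**:
`Γ(s) ∫_ℝ (t²+y²)^{-s} e(-nt) dt = √π ∫₀^∞ u^{(s-1/2)-1} e^{-(y²u + π²n²/u)} du` (`Re s > 1/2`).
[cite: Iwaniec2002, (3.18)–(3.19), PDF p. 46] -/
theorem integral_sq_add_sq_cpow_neg_mul_cexp_mul_Gamma {y : ℝ} (hy : 0 < y) (n : ℝ) {s : ℂ}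
    (hs : 1 / 2 < s.re) :
    (∫ t : ℝ, ((t ^ 2 + y ^ 2 : ℝ) : ℂ) ^ (-s) * Complex.exp (-(2 * π * I * n * t))) * Complex.Gamma s =
      ((Real.sqrt π : ℝ) : ℂ) *
        ∫ u in Ioi (0 : ℝ), (u : ℂ) ^ ((s - 1 / 2) - 1) * (Real.exp (-(y ^ 2 * u + π ^ 2 * n ^ 2 / u)) : ℂ) := by
  have hs0 : 0 < s.re := by linarith
  -- Step 1: `Γ(s) · LHS = ∫_t ∫_u kernel`
  have step1 : (∫ t : ℝ, ((t ^ 2 + y ^ 2 : ℝ) : ℂ) ^ (-s) * Complex.exp (-(2 * π * I * n * t))) * Complex.Gamma s =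
      ∫ t : ℝ, ∫ u in Ioi (0 : ℝ), bassetKernel s y n (t, u) := by
    rw [← integral_mul_const]
    refine integral_congr_ae (Eventually.of_forall fun t => ?_)
    simp only [bassetKernel]
    rw [integral_mul_const, integral_cpow_mul_exp_neg_mul_sq_add_sq hs0 hy t]
    ring
  -- Step 2: swap
  have step2 : (∫ t : ℝ, ∫ u in Ioi (0 : ℝ), bassetKernel s y n (t, u)) =
      ∫ u in Ioi (0 : ℝ), ∫ t : ℝ, bassetKernel s y n (t, u) :=
    integral_integral_swap (integrable_bassetKernel hs hy)
  -- Step 3: the `t`-integral is a Gaussian Fourier transform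
  have step3 : ∀ u : ℝ, 0 < u → (∫ t : ℝ, bassetKernel s y n (t, u)) =
      (u : ℂ) ^ (s - 1) * Complex.exp (-((y ^ 2 * u : ℝ) : ℂ)) *
        (((Real.sqrt (π / u) : ℝ) : ℂ) * Complex.exp (-((π ^ 2 * n ^ 2 / u : ℝ) : ℂ))) := by
    intro u hu
    rw [← integral_cexp_neg_mul_sq_mul_cexp hu n, ← integral_const_mul]
    refine integral_congr_ae (Eventually.of_forall fun t => ?_)
    simp only [bassetKernel]
    have e : Complex.exp (-(((t ^ 2 + y ^ 2 : ℝ) : ℂ) * (u : ℂ))) =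
        Complex.exp (-((y ^ 2 * u : ℝ) : ℂ)) * Complex.exp (-((u : ℂ) * (t : ℂ) ^ 2)) := by
      rw [← Complex.exp_add]; congr 1; push_cast; ring
    rw [e]; ring
  rw [step1, step2, ← integral_const_mul]
  refine setIntegral_congr_fun measurableSet_Ioi fun u hu => ?_
  have hu' : (0 : ℝ) < u := hu
  rw [step3 u hu']
  have hsq : Real.sqrt (π / u) = Real.sqrt π * u ^ (-(1 / 2 : ℝ)) := by
    rw [Real.sqrt_div Real.pi_pos.le, Real.sqrt_eq_rpow u, Real.rpow_neg hu'.le, div_eq_mul_inv]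
  rw [hsq]
  have hcp : (u : ℂ) ^ ((s - 1 / 2) - 1) = (u : ℂ) ^ (s - 1) * (((u ^ (-(1 / 2 : ℝ)) : ℝ) : ℂ)) := by
    rw [Complex.ofReal_cpow hu'.le, show ((-(1 / 2 : ℝ) : ℝ) : ℂ) = -(1 / 2 : ℂ) by push_cast; ring,
      ← Complex.cpow_add _ _ (Complex.ofReal_ne_zero.mpr hu'.ne')]
    congr 1; ring
  rw [hcp, show ((Real.exp (-(y ^ 2 * u + π ^ 2 * n ^ 2 / u)) : ℝ) : ℂ) =
      Complex.exp (-((y ^ 2 * u : ℝ) : ℂ)) * Complex.exp (-((π ^ 2 * n ^ 2 / u : ℝ) : ℂ)) by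
    rw [Complex.ofReal_exp, ← Complex.exp_add]; congr 1; push_cast; ring]
  push_cast
  ring

/-- **Iwaniec (3.19) / Basset's integral.** For `y > 0`, `n ≠ 0` and `Re s > 1/2`,
`∫_ℝ (t² + y²)^{-s} e(-nt) dt = 2√π (π|n|/y)^{s-1/2} K_{s-1/2}(2π|n|y) / Γ(s)
(= 2 π^s |n|^{s-1/2} y^{1/2-s} K_{s-1/2}(2π|n|y) / Γ(s))` — insert
`(t²+y²)^{-s}Γ(s) = ∫₀^∞ u^{s-1}e^{-u(t²+y²)}du`, swap, take the Gaussian Fourier transform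
`∫ e^{-ut²}e(-nt) dt = √(π/u) e^{-π²n²/u}`, and recognise `∫₀^∞ u^{s-3/2} e^{-uy² - π²n²/u} du
= 2(π|n|/y)^{s-1/2} K_{s-1/2}(2π|n|y)`. This is the integral behind the Whittaker-function
coefficients `φ_𝔞𝔟(n, s) W_s(nz)` of the Eisenstein series (Theorem 3.4, (3.20)–(3.22)).
[cite: Iwaniec2002, (3.19) & Appendix B, PDF p. 46] -/
theorem integral_sq_add_sq_cpow_neg_mul_cexp {y : ℝ} (hy : 0 < y) {n : ℝ} (hn : n ≠ 0) {s : ℂ}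
    (hs : 1 / 2 < s.re) :
    ∫ t : ℝ, ((t ^ 2 + y ^ 2 : ℝ) : ℂ) ^ (-s) * Complex.exp (-(2 * π * I * n * t)) =
      2 * ((Real.sqrt π : ℝ) : ℂ) * ((π * |n| / y : ℝ) : ℂ) ^ (s - 1 / 2) *
        besselK (s - 1 / 2) ((2 * π * |n| * y : ℝ) : ℂ) / Complex.Gamma s := by
  have hs0 : 0 < s.re := by linarith
  have hΓ : Complex.Gamma s ≠ 0 := Complex.Gamma_ne_zero_of_re_pos hs0
  rw [eq_div_iff hΓ, integral_sq_add_sq_cpow_neg_mul_cexp_mul_Gamma hy n hs]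
  -- Step 4: the Bessel integral `∫₀^∞ u^{ν-1} e^{-Au - B/u} du = 2 (√(B/A))^ν K_ν(2√(AB))`
  have hA : 0 < y ^ 2 := by positivity
  have hB : 0 < π ^ 2 * n ^ 2 := by positivity
  have hbes := (integral_cpow_mul_exp_neg_mul_sub_div hA hB (s - 1 / 2)).1
  have hsqrt1 : Real.sqrt (π ^ 2 * n ^ 2 / y ^ 2) = π * |n| / y := by
    rw [show π ^ 2 * n ^ 2 / y ^ 2 = (π * |n| / y) ^ 2 by rw [div_pow, mul_pow, sq_abs],
      Real.sqrt_sq (by positivity)]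
  have hsqrt2 : 2 * Real.sqrt (y ^ 2 * (π ^ 2 * n ^ 2)) = 2 * π * |n| * y := by
    rw [show y ^ 2 * (π ^ 2 * n ^ 2) = (π * |n| * y) ^ 2 by rw [mul_pow, mul_pow, sq_abs]; ring,
      Real.sqrt_sq (by positivity)]
    ring
  rw [← hsqrt1, ← hsqrt2, hbes]
  ring

/-- **Iwaniec (3.18).** For `y > 0` and `Re s > 1/2`,
`∫_ℝ (t² + y²)^{-s} dt = √π Γ(s - 1/2) y^{1-2s} / Γ(s)` (the case `n = 0`: the `u`-integral is
`∫₀^∞ u^{s-3/2} e^{-uy²} du = Γ(s-1/2) y^{1-2s}`). [cite: Iwaniec2002, (3.18), PDF p. 46] -/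
theorem integral_sq_add_sq_cpow_neg {y : ℝ} (hy : 0 < y) {s : ℂ} (hs : 1 / 2 < s.re) :
    ∫ t : ℝ, ((t ^ 2 + y ^ 2 : ℝ) : ℂ) ^ (-s) =
      ((Real.sqrt π : ℝ) : ℂ) * Complex.Gamma (s - 1 / 2) * ((y ^ 2 : ℝ) : ℂ) ^ (-(s - 1 / 2)) / Complex.Gamma s := by
  have hs0 : 0 < s.re := by linarith
  have hs' : 0 < (s - 1 / 2).re := by rw [Complex.sub_re]; norm_num; linarith
  have hΓ : Complex.Gamma s ≠ 0 := Complex.Gamma_ne_zero_of_re_pos hs0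
  have h := integral_sq_add_sq_cpow_neg_mul_cexp_mul_Gamma hy 0 hs
  simp only [mul_zero, zero_mul, neg_zero, Complex.ofReal_zero, Complex.exp_zero, mul_one,
    ne_eq, OfNat.ofNat_ne_zero, not_false_eq_true, zero_pow, zero_div, add_zero] at h
  rw [eq_div_iff hΓ, h]
  have hA : 0 < y ^ 2 := by positivity
  have hI : (∫ u in Ioi (0 : ℝ), (u : ℂ) ^ ((s - 1 / 2) - 1) * (Real.exp (-(y ^ 2 * u)) : ℂ)) =
      (1 / ((y ^ 2 : ℝ) : ℂ)) ^ (s - 1 / 2) * Complex.Gamma (s - 1 / 2) := by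
    rw [← Complex.integral_cpow_mul_exp_neg_mul_Ioi hs' hA]
    refine setIntegral_congr_fun measurableSet_Ioi fun u _ => ?_
    push_cast
    ring_nf
  rw [hI]
  have hy2 : ((y ^ 2 : ℝ) : ℂ) ≠ 0 := Complex.ofReal_ne_zero.mpr hA.ne'
  rw [one_div, Complex.inv_cpow _ _ (by
      rw [show ((y ^ 2 : ℝ) : ℂ) = ((y ^ 2 : ℝ) : ℂ) from rfl, Complex.arg_ofReal_of_nonneg hA.le]
      exact Real.pi_pos.ne), ← Complex.cpow_neg]
  ring

end Basset



end Literature.Analysis.FunctionSpaces
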